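import Literature.Barriers.CriticalPhenomena.WeaklySAWFourDimLogCorrectionsLemma21
import Literature.Barriers.CriticalPhenomena.WeaklySAWSojournSimplex
import Mathlib.Data.ZMod.Basic
import Mathlib.Algebra.Order.Chebyshev
import HarnessLib

/-!
# BBS 2015, §2 (finite volume approximation): the torus susceptibility `χ_N` and Lemma 2.1,
# `χ_N ↑ χ`

Companion to `WeaklySAWFourDimLogCorrections.lean` (Bauerschmidt–Brydges–Slade, CMP 337 (2015),
arXiv:1403.7422; namespace `Literature.Barriers.CriticalPhenomena.CTWSAW`: `selfIntersection`,
`pathIntegral`, `survival = c_T`, `susceptibility = χ`, `criticalNu = ν_c`) formalising **§2, "Finite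
volume approximation"** — the first step of the proof of Theorems 1.1–1.2 ("The proof begins by
approximation of `ℤ^d` by a sequence of finite tori of period `Lᴺ`"), on which the integral
representation (§3) and the renormalisation group (§4–8: Theorem 4.1 via `χ̂_N`, `χ_N = (1+z₀)χ̂_N`) operate.
Everything here is proved; no named facts.

## The torus model, by folding

The source defines `c_{N,T} = E^{Λ_N}_a(e^{-gI(T)})` for the continuous-time simple random walk on
`Λ_N = ℤ^d/Lᴺℤ^d` and proves Lemma 2.1 by COUPLING all tori to `ℤ^d`: "there is a one-to-one
correspondence between nearest-neighbour walks on `ℤ^d` started at the origin and such walks on the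
finite torus `ℤ_n^d` … by folding a walk on `ℤ^d` (the image under the canonical projection
`ℤ^d ↠ ℤ_n^d`) … Given a walk `X` on `ℤ^d` starting at `0`, we denote the folded walk on `ℤ_n^d`
by `X^n`." The folded rate-`2d` walk IS the rate-`2d` walk on the torus generated by
`Δ_Λ φ_x = Σ_{|e|=1}(φ_{x+e} - φ_x)` (§3.3), for every period `n ≥ 1`, and `I(T)` of `X^n` is
`Σ_{x ∈ ℤ_n^d}(L^x_T(X^n))² = Σ_{i,j} sᵢsⱼ𝟙{ω(i) ≡ ω(j) mod n}` in the jump-chain coordinates of the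
barrier file. We therefore DEFINE the torus quantities through the folding (general period `n`;
the source takes `n = Lᴺ`):

* folding is the tree's `Torus.proj n : ℤ^d → TorusSite d n = (ZMod n)^d`;
  `torusSelfIntersection n T ω s = I_T(X^n)`;
  `torusPathIntegral n g T ω = ∫_{Δ_k(T)} e^{-gI_T(X^n)} ds`;
* `torusWeightedExpectation d n g T Φ = E^{Λ}_0[e^{-gI(T)}Φ(X(T))]`
  (`= e^{-2dT} Σ_k Σ_ω Φ(ω(k) mod n) ∫ e^{-gI_T(X^n)}`), `torusSurvivalAt = c_{N,T}(0,b)`,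
  `torusSurvival = c_{N,T}`, `torusTwoPoint = G_{N,ν}(0,b)`,
  `torusSusceptibility d n g ν = χ_N(ν) = ∫₀^∞ c_{N,T}e^{-νT}dT ∈ [0,∞]` (the three opening
  displays of §2), `torusSusceptibility_eq_sum_torusTwoPoint` (`χ_N = Σ_b G_{N,ν}(0,b)`, the two
  printed forms of `χ_N`).

## Results (all `g ≥ 0` unless stated)

* Folding inequalities (proof of Lemma 2.1): `selfIntersection_le_torusSelfIntersection` (`I_T(X) ≤ I_T(X^n)`),
  `torusSelfIntersection_mul_le` (`I_T(X^{kn}) ≤ I_T(X^n)`), and `torusSelfIntersection_eq_of_lt`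
  (skeletons with `2|ω| < n` fold injectively: `I_T(X^n) = I_T(X)`);
* `c_{N,T} ≤ c_{N+1,T} ≤ c_T`: `torusSurvival_le_mul` / `torusSurvival_mono_of_dvd` (`c_{n,T} ≤ c_{kn,T}`),
  `torusSurvival_le_survival` (`c_{N,T} ≤ c_T`), hence `torusSusceptibility_mono_of_dvd`,
  `monotone_torusSusceptibility_pow` (`χ_{Lᴺ}` non-decreasing in `N`),
  `torusSusceptibility_le_susceptibility` (`χ_N ≤ χ`);
* `lim_N c_{N,T} = c_T`: `survival_le_torusSurvival_add` (`c_T ≤ c_{n,T} + e^{-2dT}Σ_{k≥m}(2dT)^k/k!`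
  for `2(m-1) < n` — "walks which do not reach distance `½Lᴺ` do not contribute to the difference;
  walks which do must take at least `½Lᴺ` steps"), `tendsto_poissonTail`, **`tendsto_torusSurvival`**
  (`c_{N,T} → c_T`);
* **Lemma 2.1**: `tendsto_torusSusceptibility` — `χ_n(ν) → χ(ν)` in `[0,∞]` for EVERY real `ν`
  (including `χ = ∞` below `ν_c`), along any sequence of periods (Fatou + `χ_N ≤ χ`; the source uses
  monotone convergence along `Lᴺ`), `tendsto_torusSusceptibility_pow` (along `Λ_N`, `L ≥ 2`);
* the finite-volume bound: `sq_div_le_torusSelfIntersection` (`I(T) ≥ T²/|Λ|`, Cauchy–Schwarz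
  over the classes `x ∈ Λ`), `torusSurvival_le_exp` (`c_{N,T} ≤ e^{-gT²/|Λ|}`),
  `torusSusceptibility_le_lintegral_exp` and **`torusSusceptibility_lt_top`**
  (`χ_N(ν) ≤ ∫₀^∞ e^{-gT²/|Λ_N|}e^{-νT}dT < ∞` for all `ν ∈ ℝ`, `g > 0`);
* measurability of `T ↦ c_{N,T}` (`measurable_torusSurvival`) for the Laplace-transform calculus.

The remaining clause of Lemma 2.1 (analyticity on `Re ν > ν_c`, convergence of all derivatives,
"analyticity of Laplace transforms … Montel's theorem") is treated in its real form in the companion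
`WeaklySAWFiniteVolumeDerivatives.lean`.

Locators: Lemma 2.1 by number (arXiv = CMP numbering); the displays of §2 by content (display
numbers are not legible in the held text).
-/

noncomputable section

open MeasureTheory Filter Topology Set
open Literature.Probability.LatticeModels
open Literature.Probability.RandomPlanarGeometry.SAW.Zd (abs_sub_le_length)
open scoped ENNReal BigOperators Nat

namespace Literature.Barriers.CriticalPhenomena

namespace CTWSAW

variable {d : ℕ}

/-! ### Folding `ℤ^d ↠ ℤ^d/nℤ^d` (the tree's `Torus.proj`) -/

/-- Folding modulo `n` factors through folding modulo `kn`: sites identified on the torus of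
period `kn` are identified on the torus of period `n` (`Torus.proj` of
`Literature.Probability.LatticeModels` is the canonical projection `ℤ^d ↠ (ℤ/nℤ)^d`; for `n = 0`,
`ZMod 0 = ℤ` and it is the identity). [folklore] -/
theorem torusProj_eq_of_mul {k n : ℕ} {x y : Site d} (h : Torus.proj (k * n) x = Torus.proj (k * n) y) :
    Torus.proj n x = Torus.proj n y := by
  funext i
  have hi := congrFun h i
  simp only [Torus.proj_apply] at hi ⊢
  simpa using congrArg (ZMod.castHom (dvd_mul_left n k) (ZMod n)) hi

/-- Unfolding is unique at short range: two sites whose coordinates differ by less than `n` and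
which fold to the same point of `ℤ_n^d` are equal. [folklore] -/
theorem eq_of_torusProj_eq {n : ℕ} {x y : Site d} (hxy : ∀ i, |x i - y i| < n)
    (h : Torus.proj n x = Torus.proj n y) : x = y := by
  funext i
  have hi := congrFun h i
  simp only [Torus.proj_apply] at hi
  rw [ZMod.intCast_eq_intCast_iff_dvd_sub] at hi
  have := Int.eq_zero_of_abs_lt_dvd hi (by rw [abs_sub_comm]; exact_mod_cast hxy i)
  omega

/-- Every vertex of a walk from the origin lies in the box `{-|ω|,…,|ω|}^d`. [folklore] -/
theorem abs_getVert_apply_le {x : Site d} (ω : (zdGraph d).Walk 0 x) (m : ℕ) (i : Fin d) :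
    |ω.getVert m i| ≤ ω.length := by
  have h := abs_sub_le_length (ω.take m) i
  simp only [Pi.zero_apply, sub_zero] at h
  refine h.trans ?_
  have : (ω.take m).length ≤ ω.length := by
    rw [SimpleGraph.Walk.take_length]; exact min_le_right _ _
  exact_mod_cast this

/-- Two vertices of a walk `ω` from the origin with `2|ω| < n` coincide as soon as they coincide
modulo `n` (both lie in `{-|ω|,…,|ω|}^d`). [cite: BauerschmidtBrydgesSlade2015LogCorr, §2, proof of Lemma 2.1 ("walks which do not reach distance ½Lᴺ from the origin do not contribute to the difference")] -/
theorem getVert_eq_of_torusProj_eq {n : ℕ} {x : Site d} (ω : (zdGraph d).Walk 0 x)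
    (hn : 2 * ω.length < n) {a b : ℕ}
    (h : Torus.proj n (ω.getVert a) = Torus.proj n (ω.getVert b)) : ω.getVert a = ω.getVert b := by
  refine eq_of_torusProj_eq (fun i => ?_) h
  have h3 : |ω.getVert a i - ω.getVert b i| ≤ 2 * ω.length :=
    calc |ω.getVert a i - ω.getVert b i| ≤ |ω.getVert a i| + |ω.getVert b i| := abs_sub _ _
      _ ≤ ω.length + ω.length := add_le_add (abs_getVert_apply_le ω a i) (abs_getVert_apply_le ω b i)
      _ = 2 * ω.length := by ring
  have h4 : ((2 * ω.length : ℕ) : ℤ) < n := by exact_mod_cast hn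
  push_cast at h4
  exact h3.trans_lt h4

/-! ### The folded self-intersection local time `I_T(X^n)` -/

/-- `I_T(X^n) = Σ_{x ∈ ℤ_n^d} (L^x_T(X^n))²`, the self-intersection local time up to time `T` of
the FOLDED trajectory `X^n` (skeleton `ω` on `ℤ^d`, sojourn times `sojourns T s`, positions read
modulo `n`): `Σ_{i,j ≤ |ω|} sᵢ sⱼ 𝟙{ω(i) ≡ ω(j) mod n}`. For `n = 0` this is `selfIntersection`.
[cite: BauerschmidtBrydgesSlade2015LogCorr, §2, proof of Lemma 2.1 (local time `L^x_T(X)` and `I_T(X^n)`)] -/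
def torusSelfIntersection (n : ℕ) (T : ℝ) {x : Site d} (ω : (zdGraph d).Walk 0 x)
    (s : Fin ω.length → ℝ) : ℝ :=
  ∑ i : Fin (ω.length + 1), ∑ j : Fin (ω.length + 1),
    if Torus.proj n (ω.getVert i) = Torus.proj n (ω.getVert j) then
      sojourns T s i * sojourns T s j else 0

/-- "A folded walk can only have more intersections than its unfolding": `I_T(X) ≤ I_T(X^n)`
(on the sojourn simplex). [cite: BauerschmidtBrydgesSlade2015LogCorr, §2, proof of Lemma 2.1] -/
theorem selfIntersection_le_torusSelfIntersection (n : ℕ) {T : ℝ} {x : Site d}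
    (ω : (zdGraph d).Walk 0 x) {s : Fin ω.length → ℝ} (hs : s ∈ sojournSet ω.length T) :
    selfIntersection T ω s ≤ torusSelfIntersection n T ω s := by
  unfold selfIntersection torusSelfIntersection
  refine Finset.sum_le_sum fun i _ => Finset.sum_le_sum fun j _ => ?_
  by_cases h : ω.getVert i = ω.getVert j
  · rw [if_pos h, if_pos (by rw [h])]
  · rw [if_neg h]
    split_ifs
    · exact (mul_pos (sojourns_pos hs i) (sojourns_pos hs j)).le
    · exact le_rfl

/-- The folding inequality of the source: `I_T(X^{kn}) ≤ I_T(X^n)` — folding a torus of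
period `kn` onto one of period `n` can only create intersections.
[cite: BauerschmidtBrydgesSlade2015LogCorr, §2, proof of Lemma 2.1 (display `I_T(X^{kn}) ≤ I_T(X^n)`)] -/
theorem torusSelfIntersection_mul_le (k n : ℕ) {T : ℝ} {x : Site d}
    (ω : (zdGraph d).Walk 0 x) {s : Fin ω.length → ℝ} (hs : s ∈ sojournSet ω.length T) :
    torusSelfIntersection (k * n) T ω s ≤ torusSelfIntersection n T ω s := by
  unfold torusSelfIntersection
  refine Finset.sum_le_sum fun i _ => Finset.sum_le_sum fun j _ => ?_
  by_cases h : Torus.proj (k * n) (ω.getVert i) = Torus.proj (k * n) (ω.getVert j)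
  · rw [if_pos h, if_pos (torusProj_eq_of_mul h)]
  · rw [if_neg h]
    split_ifs
    · exact (mul_pos (sojourns_pos hs i) (sojourns_pos hs j)).le
    · exact le_rfl

/-- `I_T(X^n) ≥ 0` on the sojourn simplex. [folklore] -/
theorem torusSelfIntersection_nonneg (n : ℕ) {T : ℝ} {x : Site d} (ω : (zdGraph d).Walk 0 x)
    {s : Fin ω.length → ℝ} (hs : s ∈ sojournSet ω.length T) :
    0 ≤ torusSelfIntersection n T ω s :=
  (selfIntersection_nonneg ω hs).trans (selfIntersection_le_torusSelfIntersection n ω hs)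

/-- Short skeletons fold injectively: if `2|ω| < n` then `I_T(X^n) = I_T(X)`.
[cite: BauerschmidtBrydgesSlade2015LogCorr, §2, proof of Lemma 2.1 (walks not reaching distance ½Lᴺ)] -/
theorem torusSelfIntersection_eq_of_lt {n : ℕ} {x : Site d} (ω : (zdGraph d).Walk 0 x)
    (hn : 2 * ω.length < n) (T : ℝ) (s : Fin ω.length → ℝ) :
    torusSelfIntersection n T ω s = selfIntersection T ω s := by
  unfold selfIntersection torusSelfIntersection
  refine Finset.sum_congr rfl fun i _ => Finset.sum_congr rfl fun j _ => ?_
  have hiff : Torus.proj n (ω.getVert i) = Torus.proj n (ω.getVert j) ↔ ω.getVert i = ω.getVert j :=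
    ⟨getVert_eq_of_torusProj_eq ω hn, fun h => by rw [h]⟩
  simp only [hiff]

/-- `I_T(X^n)` is a continuous (polynomial) function of `(T, s)`. [folklore] -/
theorem continuous_torusSelfIntersection (n : ℕ) {x : Site d} (ω : (zdGraph d).Walk 0 x) :
    Continuous fun p : ℝ × (Fin ω.length → ℝ) => torusSelfIntersection n p.1 ω p.2 := by
  unfold torusSelfIntersection
  refine continuous_finsetSum _ fun i _ => continuous_finsetSum _ fun j _ => ?_
  by_cases h : Torus.proj n (ω.getVert i) = Torus.proj n (ω.getVert j)
  · simp only [h, if_true]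
    exact (continuous_sojourns_apply i).mul (continuous_sojourns_apply j)
  · simp only [h, if_false]
    exact continuous_const

/-! ### The torus path integral, `c_{N,T}` and `χ_N` (jump-chain representation, folded) -/

/-- `∫_{Δ_k(T)} e^{-g I_T(X^n)} ds` over the sojourn simplex of the skeleton `ω` (`k = |ω|`).
[cite: BauerschmidtBrydgesSlade2015LogCorr, §2 (definition of c_{N,T}, first display) with §1.1 (jump-chain representation)] -/
def torusPathIntegral (n : ℕ) (g T : ℝ) {x : Site d} (ω : (zdGraph d).Walk 0 x) : ℝ≥0∞ :=
  ∫⁻ s in sojournSet ω.length T,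
    ENNReal.ofReal (Real.exp (-g * torusSelfIntersection n T ω s))

open Classical in
/-- `E^{Λ}_0[e^{-g I(T)} Φ(X(T))]` for the rate-`2d` continuous-time simple random walk on the
discrete torus `Λ = ℤ^d/nℤ^d` (generator `Δ_Λ φ_x = Σ_{|e|=1}(φ_{x+e} - φ_x)`), realised — as in
the proof of Lemma 2.1 of the source — as the FOLDING `X^n` of the walk `X` on `ℤ^d`: the law of
`X^n` is that of the torus walk, and `I(T)` of `X^n` is `torusSelfIntersection`. Jump-chain form:
`e^{-2dT} Σ_k Σ_x Σ_{ω : 0 → x, |ω| = k} Φ(x mod n) ∫_{Δ_k(T)} e^{-g I_T(X^n)} ds`.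
[cite: BauerschmidtBrydgesSlade2015LogCorr, §2 (definition of c_{N,T}, first display) and proof of Lemma 2.1 (coupling by folding)] -/
def torusWeightedExpectation (d n : ℕ) (g T : ℝ) (Φ : TorusSite d n → ℝ≥0∞) : ℝ≥0∞ :=
  ENNReal.ofReal (Real.exp (-(2 * d) * T)) *
    ∑' k : ℕ, ∑ x ∈ box d k, ∑ ω ∈ (zdGraph d).finsetWalkLength k (0 : Site d) x,
      Φ (Torus.proj n x) * torusPathIntegral n g T ω

/-- `c_{N,T}(0,b) = E^{Λ_N}_0(e^{-gI(T)} 𝟙_{X(T) = b})` on the torus of period `n` (`= Lᴺ`).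
[cite: BauerschmidtBrydgesSlade2015LogCorr, §2 (definition of c_{N,T}(a,b), first display)] -/
def torusSurvivalAt (d n : ℕ) (g T : ℝ) (b : TorusSite d n) : ℝ≥0∞ :=
  torusWeightedExpectation d n g T fun y => if y = b then 1 else 0

/-- `c_{N,T} = E^{Λ_N}_0(e^{-gI(T)})` on the torus of period `n` (`= Lᴺ`).
[cite: BauerschmidtBrydgesSlade2015LogCorr, §2 (definition of c_{N,T}, first display)] -/
def torusSurvival (d n : ℕ) (g T : ℝ) : ℝ≥0∞ :=
  torusWeightedExpectation d n g T fun _ => 1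

/-- The torus two-point function `G_{N,ν}(0,b) = ∫₀^∞ c_{N,T}(0,b) e^{-νT} dT`.
[cite: BauerschmidtBrydgesSlade2015LogCorr, §2 (definition of G_{N,ν}(a,b), second display)] -/
def torusTwoPoint (d n : ℕ) (g ν : ℝ) (b : TorusSite d n) : ℝ≥0∞ :=
  ∫⁻ T in Ioi (0 : ℝ), torusSurvivalAt d n g T b * ENNReal.ofReal (Real.exp (-ν * T))

/-- The **torus susceptibility** `χ_N(ν) = ∫₀^∞ c_{N,T} e^{-νT} dT ∈ [0, ∞]` (period `n = Lᴺ`).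
[cite: BauerschmidtBrydgesSlade2015LogCorr, §2 (definition of χ_N, third display)] -/
def torusSusceptibility (d n : ℕ) (g ν : ℝ) : ℝ≥0∞ :=
  ∫⁻ T in Ioi (0 : ℝ), torusSurvival d n g T * ENNReal.ofReal (Real.exp (-ν * T))

/-! ### Comparison of path integrals: the folding inequalities integrated -/

/-- `∫ e^{-gI_T(X^n)} ≤ ∫ e^{-gI_T(X)}` (`g ≥ 0`). [cite: BauerschmidtBrydgesSlade2015LogCorr, §2, proof of Lemma 2.1 ("a folded walk can only have more intersections than its unfolding")] -/
theorem torusPathIntegral_le_pathIntegral (n : ℕ) {g : ℝ} (hg : 0 ≤ g) (T : ℝ) {x : Site d}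
    (ω : (zdGraph d).Walk 0 x) : torusPathIntegral n g T ω ≤ pathIntegral g T ω := by
  unfold torusPathIntegral pathIntegral
  refine setLIntegral_mono' (measurableSet_sojournSet _ _) fun s hs => ?_
  refine ENNReal.ofReal_le_ofReal (Real.exp_le_exp.2 ?_)
  exact mul_le_mul_of_nonpos_left (selfIntersection_le_torusSelfIntersection n ω hs)
    (neg_nonpos.2 hg)

/-- `∫ e^{-gI_T(X^n)} ≤ ∫ e^{-gI_T(X^{kn})}` (`g ≥ 0`). [cite: BauerschmidtBrydgesSlade2015LogCorr, §2, proof of Lemma 2.1 (display `e^{-gI_{N+1,T}(X)} ≥ e^{-gI_{N,T}(X)}`)] -/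
theorem torusPathIntegral_le_mul (k n : ℕ) {g : ℝ} (hg : 0 ≤ g) (T : ℝ) {x : Site d}
    (ω : (zdGraph d).Walk 0 x) : torusPathIntegral n g T ω ≤ torusPathIntegral (k * n) g T ω := by
  unfold torusPathIntegral
  refine setLIntegral_mono' (measurableSet_sojournSet _ _) fun s hs => ?_
  refine ENNReal.ofReal_le_ofReal (Real.exp_le_exp.2 ?_)
  exact mul_le_mul_of_nonpos_left (torusSelfIntersection_mul_le k n ω hs) (neg_nonpos.2 hg)

/-- Short skeletons: `2|ω| < n ⟹ ∫ e^{-gI_T(X^n)} = ∫ e^{-gI_T(X)}`.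
[cite: BauerschmidtBrydgesSlade2015LogCorr, §2, proof of Lemma 2.1] -/
theorem torusPathIntegral_eq_of_lt {n : ℕ} {x : Site d} (ω : (zdGraph d).Walk 0 x)
    (hn : 2 * ω.length < n) (g T : ℝ) : torusPathIntegral n g T ω = pathIntegral g T ω := by
  unfold torusPathIntegral pathIntegral
  simp_rw [torusSelfIntersection_eq_of_lt ω hn]

/-- For `T ≤ 0` the sojourn simplex is empty and the torus path integral vanishes. [folklore] -/
theorem torusPathIntegral_of_nonpos (n : ℕ) (g : ℝ) {T : ℝ} (hT : T ≤ 0) {x : Site d}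
    (ω : (zdGraph d).Walk 0 x) : torusPathIntegral n g T ω = 0 := by
  rw [torusPathIntegral, sojournSet_eq_empty_of_nonpos hT, setLIntegral_empty]

/-- For `T ≤ 0` the path integral vanishes. [folklore] -/
theorem pathIntegral_of_nonpos (g : ℝ) {T : ℝ} (hT : T ≤ 0) {x : Site d}
    (ω : (zdGraph d).Walk 0 x) : pathIntegral g T ω = 0 := by
  rw [pathIntegral, sojournSet_eq_empty_of_nonpos hT, setLIntegral_empty]


/-! ### Monotonicity in the period: `c_{n,T} ≤ c_{kn,T} ≤ c_T`, `χ_n ≤ χ_{kn} ≤ χ` -/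

/-- The `k`-jump layer of the torus expectation with a weight `Φ ≤ 1` is at most the
corresponding `ℤ^d` layer at weight `1`, hence at most `(2d)^k T^k/k!`. [folklore] -/
theorem torusLayer_le (n k : ℕ) {g : ℝ} (hg : 0 ≤ g) {T : ℝ} (hT : 0 < T)
    {Φ : TorusSite d n → ℝ≥0∞} (hΦ : ∀ y, Φ y ≤ 1) :
    ∑ x ∈ box d k, ∑ ω ∈ (zdGraph d).finsetWalkLength k (0 : Site d) x,
        Φ (Torus.proj n x) * torusPathIntegral n g T ω
      ≤ (2 * d : ℝ≥0∞) ^ k * ENNReal.ofReal (T ^ k / k !) := by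
  calc ∑ x ∈ box d k, ∑ ω ∈ (zdGraph d).finsetWalkLength k (0 : Site d) x,
        Φ (Torus.proj n x) * torusPathIntegral n g T ω
      ≤ ∑ x ∈ box d k, ∑ ω ∈ (zdGraph d).finsetWalkLength k (0 : Site d) x,
          (1 : ℝ≥0∞) * pathIntegral g T ω :=
        Finset.sum_le_sum fun x _ => Finset.sum_le_sum fun ω _ =>
          mul_le_mul' (hΦ _) (torusPathIntegral_le_pathIntegral n hg T ω)
    _ ≤ _ := layer_le d k hg hT fun _ => le_rfl

/-- `E^{Λ}_0[e^{-gI(T)} Φ] ≤ 1` for `g ≥ 0`, `Φ ≤ 1`. [folklore] -/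
theorem torusWeightedExpectation_le_one (n : ℕ) {g : ℝ} (hg : 0 ≤ g) {T : ℝ} (hT : 0 < T)
    {Φ : TorusSite d n → ℝ≥0∞} (hΦ : ∀ y, Φ y ≤ 1) :
    torusWeightedExpectation d n g T Φ ≤ 1 := by
  unfold torusWeightedExpectation
  calc ENNReal.ofReal (Real.exp (-(2 * d) * T)) *
        ∑' k, ∑ x ∈ box d k, ∑ ω ∈ (zdGraph d).finsetWalkLength k (0 : Site d) x,
          Φ (Torus.proj n x) * torusPathIntegral n g T ω
      ≤ ENNReal.ofReal (Real.exp (-(2 * d) * T)) *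
          ∑' k, (2 * d : ℝ≥0∞) ^ k * ENNReal.ofReal (T ^ k / k !) :=
        mul_le_mul' le_rfl (ENNReal.tsum_le_tsum fun k => torusLayer_le n k hg hT hΦ)
    _ = 1 := by
        rw [tsum_layer_zero d hT.le, ← ENNReal.ofReal_mul (Real.exp_pos _).le, ← Real.exp_add]
        norm_num

/-- `c_{N,T} ≤ 1` (`g ≥ 0`). [cite: BauerschmidtBrydgesSlade2015LogCorr, §2 (c_{N,T} ≤ c_T ≤ 1)] -/
theorem torusSurvival_le_one (n : ℕ) {g : ℝ} (hg : 0 ≤ g) {T : ℝ} (hT : 0 < T) :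
    torusSurvival d n g T ≤ 1 :=
  torusWeightedExpectation_le_one n hg hT fun _ => le_rfl

/-- **`c_{N,T} ≤ c_T`** (`g ≥ 0`): folding only creates intersections.
[cite: BauerschmidtBrydgesSlade2015LogCorr, §2, proof of Lemma 2.1 (display `c_{N,T} ≤ c_{N+1,T} ≤ c_T`)] -/
theorem torusSurvival_le_survival (n : ℕ) {g : ℝ} (hg : 0 ≤ g) (T : ℝ) :
    torusSurvival d n g T ≤ survival d g T := by
  unfold torusSurvival torusWeightedExpectation survival weightedExpectation
  refine mul_le_mul' le_rfl (ENNReal.tsum_le_tsum fun k => ?_)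
  exact Finset.sum_le_sum fun x _ => Finset.sum_le_sum fun ω _ =>
    mul_le_mul' le_rfl (torusPathIntegral_le_pathIntegral n hg T ω)

/-- **`c_{n,T} ≤ c_{kn,T}`** (`g ≥ 0`): the first inequality of `c_{N,T} ≤ c_{N+1,T} ≤ c_T`, from
the folding inequality. [cite: BauerschmidtBrydgesSlade2015LogCorr, §2, proof of Lemma 2.1 (display `c_{N,T} ≤ c_{N+1,T} ≤ c_T`)] -/
theorem torusSurvival_le_mul (k n : ℕ) {g : ℝ} (hg : 0 ≤ g) (T : ℝ) :
    torusSurvival d n g T ≤ torusSurvival d (k * n) g T := by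
  unfold torusSurvival torusWeightedExpectation
  refine mul_le_mul' le_rfl (ENNReal.tsum_le_tsum fun k' => ?_)
  exact Finset.sum_le_sum fun x _ => Finset.sum_le_sum fun ω _ =>
    mul_le_mul' le_rfl (torusPathIntegral_le_mul k n hg T ω)

/-- `c_{n,T}` is non-decreasing along the divisibility order of the period (in particular in
`N` for `n = Lᴺ`). [cite: BauerschmidtBrydgesSlade2015LogCorr, §2, Lemma 2.1 (monotonicity in N)] -/
theorem torusSurvival_mono_of_dvd {n m : ℕ} (h : n ∣ m) {g : ℝ} (hg : 0 ≤ g) (T : ℝ) :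
    torusSurvival d n g T ≤ torusSurvival d m g T := by
  obtain ⟨k, rfl⟩ := h
  rw [mul_comm]
  exact torusSurvival_le_mul k n hg T

/-- **`χ_N(ν) ≤ χ(ν)`** (`g ≥ 0`, every real `ν`). [cite: BauerschmidtBrydgesSlade2015LogCorr, Lemma 2.1] -/
theorem torusSusceptibility_le_susceptibility (n : ℕ) {g : ℝ} (hg : 0 ≤ g) (ν : ℝ) :
    torusSusceptibility d n g ν ≤ susceptibility d g ν := by
  unfold torusSusceptibility susceptibility
  exact lintegral_mono fun T => mul_le_mul' (torusSurvival_le_survival n hg T) le_rfl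

/-- **`χ_N(ν)` is non-decreasing in `N`** (along `n ∣ m`, in particular `n = Lᴺ`; `g ≥ 0`).
[cite: BauerschmidtBrydgesSlade2015LogCorr, Lemma 2.1 ("χ_N(ν) is non-decreasing in N")] -/
theorem torusSusceptibility_mono_of_dvd {n m : ℕ} (h : n ∣ m) {g : ℝ} (hg : 0 ≤ g) (ν : ℝ) :
    torusSusceptibility d n g ν ≤ torusSusceptibility d m g ν := by
  unfold torusSusceptibility
  exact lintegral_mono fun T => mul_le_mul' (torusSurvival_mono_of_dvd h hg T) le_rfl

/-- `N ↦ χ_{Lᴺ}(ν)` is monotone. [cite: BauerschmidtBrydgesSlade2015LogCorr, Lemma 2.1] -/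
theorem monotone_torusSusceptibility_pow (L : ℕ) {g : ℝ} (hg : 0 ≤ g) (ν : ℝ) :
    Monotone fun N : ℕ => torusSusceptibility d (L ^ N) g ν :=
  monotone_nat_of_le_succ fun N =>
    torusSusceptibility_mono_of_dvd (pow_dvd_pow L N.le_succ) hg ν

/-! ### Convergence `c_{N,T} → c_T`: only long skeletons see the torus -/

/-- The Poisson tail `e^{-2dT} Σ_{k ≥ m} (2dT)^k/k!` bounding the contribution of skeletons with at
least `m` jumps. [folklore] -/
def poissonTail (d : ℕ) (T : ℝ) (m : ℕ) : ℝ≥0∞ :=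
  ENNReal.ofReal (Real.exp (-(2 * d) * T)) *
    ∑' j : ℕ, (2 * d : ℝ≥0∞) ^ (j + m) * ENNReal.ofReal (T ^ (j + m) / (j + m)!)

/-- **`c_T ≤ c_{n,T} + e^{-2dT} Σ_{k ≥ m}(2dT)^k/k!`** whenever `2(m-1) < n`: skeletons with fewer
than `m` jumps fold injectively into the torus of period `n`, the others have total Poisson weight
at most the tail. [cite: BauerschmidtBrydgesSlade2015LogCorr, §2, proof of Lemma 2.1 ("|c_T - c_{T,N}| ≤ 2P(M_T > ½Lᴺ)")] -/
theorem survival_le_torusSurvival_add {n m : ℕ} (hmn : 2 * m ≤ n + 1) {g : ℝ} (hg : 0 ≤ g)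
    {T : ℝ} (hT : 0 < T) :
    survival d g T ≤ torusSurvival d n g T + poissonTail d T m := by
  classical
  set a : ℕ → ℝ≥0∞ := fun k => ∑ x ∈ box d k,
    ∑ ω ∈ (zdGraph d).finsetWalkLength k (0 : Site d) x, (1 : ℝ≥0∞) * pathIntegral g T ω with ha
  set b : ℕ → ℝ≥0∞ := fun k => ∑ x ∈ box d k,
    ∑ ω ∈ (zdGraph d).finsetWalkLength k (0 : Site d) x,
      (1 : ℝ≥0∞) * torusPathIntegral n g T ω with hb
  set f : ℕ → ℝ≥0∞ := fun k => (2 * d : ℝ≥0∞) ^ k * ENNReal.ofReal (T ^ k / k !) with hf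
  have hab : ∀ k, k < m → a k = b k := by
    intro k hk
    refine Finset.sum_congr rfl fun x _ => Finset.sum_congr rfl fun ω hω => ?_
    rw [SimpleGraph.mem_finsetWalkLength_iff] at hω
    rw [torusPathIntegral_eq_of_lt ω (by rw [hω]; omega)]
  have hsplit : ∑' k, a k = (∑ k ∈ Finset.range m, a k) + ∑' j, a (j + m) :=
    (Summable.sum_add_tsum_nat_add' (f := a) (k := m) ENNReal.summable).symm
  have h1 : ∑ k ∈ Finset.range m, a k ≤ ∑' k, b k := by
    calc ∑ k ∈ Finset.range m, a k = ∑ k ∈ Finset.range m, b k :=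
          Finset.sum_congr rfl fun k hk => hab k (Finset.mem_range.1 hk)
      _ ≤ ∑' k, b k := ENNReal.sum_le_tsum _
  have h2 : ∑' j, a (j + m) ≤ ∑' j, f (j + m) :=
    ENNReal.tsum_le_tsum fun j => layer_le d (j + m) hg hT fun _ => le_rfl
  unfold survival weightedExpectation torusSurvival torusWeightedExpectation poissonTail
  rw [← mul_add]
  refine mul_le_mul' le_rfl ?_
  change ∑' k, a k ≤ ∑' k, b k + ∑' j, f (j + m)
  rw [hsplit]
  exact add_le_add h1 h2

/-- The Poisson tail tends to `0` as `m → ∞` (`T ≥ 0`): `Σ_k (2dT)^k/k! = e^{2dT} < ∞`. [folklore] -/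
theorem tendsto_poissonTail (d : ℕ) {T : ℝ} (hT : 0 ≤ T) :
    Tendsto (poissonTail d T) atTop (𝓝 0) := by
  have hsum : ∑' k : ℕ, (2 * d : ℝ≥0∞) ^ k * ENNReal.ofReal (T ^ k / k !) ≠ ∞ := by
    rw [tsum_layer_zero d hT]; exact ENNReal.ofReal_ne_top
  have h := ENNReal.tendsto_sum_nat_add _ hsum
  have h2 := ENNReal.Tendsto.const_mul h
    (Or.inr (ENNReal.ofReal_ne_top (r := Real.exp (-(2 * d) * T))))
  rw [mul_zero] at h2
  exact h2

/-- `c_{N,T} = 0 = c_T` for `T ≤ 0` (empty sojourn simplex; a junk region of the definitions).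
[folklore] -/
theorem torusSurvival_of_nonpos (n : ℕ) (g : ℝ) {T : ℝ} (hT : T ≤ 0) :
    torusSurvival d n g T = 0 := by
  unfold torusSurvival torusWeightedExpectation
  simp [torusPathIntegral_of_nonpos n g hT]

/-- `c_T = 0` for `T ≤ 0` (empty sojourn simplex). [folklore] -/
theorem survival_of_nonpos (g : ℝ) {T : ℝ} (hT : T ≤ 0) : survival d g T = 0 := by
  unfold survival weightedExpectation
  simp [pathIntegral_of_nonpos g hT]

/-- **`lim_{N→∞} c_{N,T} = c_T`** (`g ≥ 0`; along any sequence of periods `n → ∞`).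
[cite: BauerschmidtBrydgesSlade2015LogCorr, §2, proof of Lemma 2.1 (display `lim_{N→∞} c_{N,T} = c_T`)] -/
theorem tendsto_torusSurvival {g : ℝ} (hg : 0 ≤ g) (T : ℝ) :
    Tendsto (fun n => torusSurvival d n g T) atTop (𝓝 (survival d g T)) := by
  rcases le_or_gt T 0 with hT | hT
  · simp only [torusSurvival_of_nonpos _ g hT, survival_of_nonpos g hT]
    exact tendsto_const_nhds
  have hfin : survival d g T ≠ ∞ := ((survival_le_one hg d hT).trans_lt ENNReal.one_lt_top).ne
  have hm : Tendsto (fun n : ℕ => (n + 1) / 2) atTop atTop :=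
    tendsto_atTop_atTop.2 fun b => ⟨2 * b, fun n hn => by omega⟩
  have htail : Tendsto (fun n : ℕ => poissonTail d T ((n + 1) / 2)) atTop (𝓝 0) :=
    (tendsto_poissonTail d hT.le).comp hm
  have hlow : Tendsto (fun n : ℕ => survival d g T - poissonTail d T ((n + 1) / 2)) atTop
      (𝓝 (survival d g T)) := by
    have := ENNReal.Tendsto.sub (tendsto_const_nhds (x := survival d g T)) htail (Or.inl hfin)
    rwa [tsub_zero] at this
  refine tendsto_of_tendsto_of_tendsto_of_le_of_le hlow tendsto_const_nhds (fun n => ?_) fun n => ?_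
  · exact tsub_le_iff_right.2 (survival_le_torusSurvival_add (by omega) hg hT)
  · exact torusSurvival_le_survival n hg T


/-! ### Measurability in `T` -/

/-- `T ↦ ∫_{Δ_k(T)} f(T,s) ds` is measurable for a jointly measurable integrand (the sojourn
simplex is jointly measurable in `(T, s)`; `Measurable.lintegral_prod_right'`). [folklore] -/
theorem measurable_setLIntegral_sojournSet {k : ℕ} {f : ℝ × (Fin k → ℝ) → ℝ≥0∞}
    (hf : Measurable f) : Measurable fun T => ∫⁻ s in sojournSet k T, f (T, s) := by
  set S : Set (ℝ × (Fin k → ℝ)) := {p | p.2 ∈ sojournSet k p.1} with hSdef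
  have hS : MeasurableSet S := by
    have h1 : S = (⋂ i, {p : ℝ × (Fin k → ℝ) | 0 < p.2 i}) ∩ {p | ∑ i, p.2 i < p.1} := by
      ext p
      simp [hSdef, sojournSet]
    rw [h1]
    refine (MeasurableSet.iInter fun i => ?_).inter ?_
    · exact measurableSet_lt measurable_const ((measurable_pi_apply i).comp measurable_snd)
    · exact measurableSet_lt
        (Finset.measurable_sum _ fun i _ => (measurable_pi_apply i).comp measurable_snd)
        measurable_fst
  have hF : Measurable fun T => ∫⁻ s, S.indicator f (T, s) := (hf.indicator hS).lintegral_prod_right'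
  have heq : (fun T => ∫⁻ s in sojournSet k T, f (T, s)) = fun T => ∫⁻ s, S.indicator f (T, s) := by
    funext T
    rw [← lintegral_indicator (measurableSet_sojournSet _ _)]
    congr 1 with s
  rw [heq]
  exact hF

/-- `T ↦ ∫_{Δ_k(T)} e^{-gI_T(X^n)} ds` is measurable. [folklore] -/
theorem measurable_torusPathIntegral (n : ℕ) (g : ℝ) {x : Site d} (ω : (zdGraph d).Walk 0 x) :
    Measurable fun T => torusPathIntegral n g T ω := by
  unfold torusPathIntegral
  exact measurable_setLIntegral_sojournSet
    ((Real.continuous_exp.comp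
      (continuous_const.mul (continuous_torusSelfIntersection n ω))).measurable.ennreal_ofReal)

/-- `T ↦ E^{Λ}_0[e^{-gI(T)} Φ(X(T))]` is measurable. [folklore] -/
theorem measurable_torusWeightedExpectation (d n : ℕ) (g : ℝ) (Φ : TorusSite d n → ℝ≥0∞) :
    Measurable fun T => torusWeightedExpectation d n g T Φ := by
  unfold torusWeightedExpectation
  refine Measurable.mul
    ((Real.continuous_exp.comp (continuous_const.mul continuous_id)).measurable.ennreal_ofReal) ?_
  refine Measurable.tsum fun k => ?_
  refine Finset.measurable_sum _ fun x _ => Finset.measurable_sum _ fun ω _ => ?_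
  exact (measurable_torusPathIntegral n g ω).const_mul _

/-- `T ↦ c_{N,T}` is measurable. [folklore] -/
theorem measurable_torusSurvival (d n : ℕ) (g : ℝ) : Measurable fun T => torusSurvival d n g T :=
  measurable_torusWeightedExpectation d n g _

/-! ### Lemma 2.1: `χ_N ↑ χ` -/

/-- **Lemma 2.1 (convergence)**: `lim_{N→∞} χ_N(ν) = χ(ν)` in `[0,∞]` for every real `ν` (with
`χ(ν) = ∞` for `ν ≤ ν_c`); `g ≥ 0`, along any sequence of periods `n → ∞` (the source: `n = Lᴺ`,
monotone convergence; here: Fatou for the lower bound and `χ_N ≤ χ` for the upper bound).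
[cite: BauerschmidtBrydgesSlade2015LogCorr, Lemma 2.1 (display `χ(ν) = lim_{N→∞} χ_N(ν)` for ν ∈ ℝ)] -/
theorem tendsto_torusSusceptibility {g : ℝ} (hg : 0 ≤ g) (ν : ℝ) :
    Tendsto (fun n => torusSusceptibility d n g ν) atTop (𝓝 (susceptibility d g ν)) := by
  refine tendsto_of_le_liminf_of_limsup_le ?_ ?_
  · have hmeas : ∀ n : ℕ, Measurable fun T =>
        torusSurvival d n g T * ENNReal.ofReal (Real.exp (-ν * T)) := fun n =>
      (measurable_torusSurvival d n g).mul
        (Real.continuous_exp.comp (continuous_const.mul continuous_id)).measurable.ennreal_ofReal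
    unfold susceptibility torusSusceptibility
    calc ∫⁻ T in Ioi (0 : ℝ), survival d g T * ENNReal.ofReal (Real.exp (-ν * T))
        = ∫⁻ T in Ioi (0 : ℝ), liminf (fun n : ℕ =>
            torusSurvival d n g T * ENNReal.ofReal (Real.exp (-ν * T))) atTop := by
          refine lintegral_congr fun T => ?_
          rw [(ENNReal.Tendsto.mul_const (tendsto_torusSurvival hg T)
            (Or.inr ENNReal.ofReal_ne_top)).liminf_eq]
      _ ≤ liminf (fun n : ℕ => ∫⁻ T in Ioi (0 : ℝ),
            torusSurvival d n g T * ENNReal.ofReal (Real.exp (-ν * T))) atTop :=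
          lintegral_liminf_le hmeas
  · exact limsup_le_of_le (h := Eventually.of_forall fun n =>
      torusSusceptibility_le_susceptibility n hg ν)

/-- **Lemma 2.1 along `Λ_N = ℤ^d/Lᴺℤ^d`** (`L ≥ 2`, `g ≥ 0`): `χ_{Lᴺ}(ν) ↑ χ(ν)` as `N → ∞`.
[cite: BauerschmidtBrydgesSlade2015LogCorr, Lemma 2.1] -/
theorem tendsto_torusSusceptibility_pow {L : ℕ} (hL : 2 ≤ L) {g : ℝ} (hg : 0 ≤ g) (ν : ℝ) :
    Tendsto (fun N : ℕ => torusSusceptibility d (L ^ N) g ν) atTop (𝓝 (susceptibility d g ν)) :=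
  (tendsto_torusSusceptibility hg ν).comp (tendsto_pow_atTop_atTop_of_one_lt hL)

/-- For `ν > ν_c` the torus susceptibilities are finite along with `χ` (`g ≥ 0`).
[cite: BauerschmidtBrydgesSlade2015LogCorr, Lemma 2.1] -/
theorem torusSusceptibility_lt_top_of_criticalNu_lt (n : ℕ) {g : ℝ} (hg : 0 ≤ g) {ν : ℝ}
    (hν : criticalNu d g < ν) : torusSusceptibility d n g ν < ∞ :=
  (torusSusceptibility_le_susceptibility n hg ν).trans_lt
    (susceptibility_lt_top_of_criticalNu_lt hg hν)

/-! ### `χ_N = Σ_{b ∈ Λ_N} G_{N,ν}(0,b)` -/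

/-- `c_{N,T} = Σ_{b ∈ Λ_N} c_{N,T}(0,b)` (`n ≥ 1`). [cite: BauerschmidtBrydgesSlade2015LogCorr, §2 (definitions of c_{N,T}(a,b) and c_{N,T})] -/
theorem sum_torusSurvivalAt (n : ℕ) [NeZero n] (g T : ℝ) :
    ∑ b : TorusSite d n, torusSurvivalAt d n g T b = torusSurvival d n g T := by
  classical
  unfold torusSurvivalAt torusSurvival torusWeightedExpectation
  rw [← Finset.mul_sum, ← Summable.tsum_finsetSum (fun _ _ => ENNReal.summable)]
  congr 1
  refine tsum_congr fun k => ?_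
  rw [Finset.sum_comm]
  refine Finset.sum_congr rfl fun x _ => ?_
  rw [Finset.sum_comm]
  refine Finset.sum_congr rfl fun ω _ => ?_
  rw [← Finset.sum_mul]
  congr 1
  rw [Finset.sum_ite_eq]
  simp

/-- **`χ_N(ν) = Σ_{b ∈ Λ_N} G_{N,ν}(0,b)`** (`n ≥ 1`): the two printed forms of `χ_N` agree.
[cite: BauerschmidtBrydgesSlade2015LogCorr, §2 (definition of χ_N, third display)] -/
theorem torusSusceptibility_eq_sum_torusTwoPoint (n : ℕ) [NeZero n] (g ν : ℝ) :
    torusSusceptibility d n g ν = ∑ b : TorusSite d n, torusTwoPoint d n g ν b := by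
  unfold torusSusceptibility torusTwoPoint
  rw [← lintegral_finsetSum]
  · refine lintegral_congr fun T => ?_
    rw [← Finset.sum_mul, sum_torusSurvivalAt]
  · intro b _
    exact (measurable_torusWeightedExpectation d n g _).mul
      (Real.continuous_exp.comp (continuous_const.mul continuous_id)).measurable.ennreal_ofReal

/-! ### Finite volume: `I(T) ≥ T²/|Λ|`, hence `χ_N(ν) < ∞` for every real `ν` (`g > 0`) -/

/-- Cauchy–Schwarz over the classes of a colouring: `(Σᵢ σᵢ)² ≤ |V| Σ_{i,j : c i = c j} σᵢσⱼ`
(`Σ_{y ∈ V} (Σ_{i : c i = y} σᵢ)² ≥ |V|⁻¹ (Σ_y Σ_{i : c i = y} σᵢ)²`). [folklore] -/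
theorem sq_sum_le_card_mul_sum_ite_eq {ι V : Type*} [Fintype V] [DecidableEq V] (s : Finset ι)
    (c : ι → V) (σ : ι → ℝ) :
    (∑ i ∈ s, σ i) ^ 2 ≤
      Fintype.card V * ∑ i ∈ s, ∑ j ∈ s, if c i = c j then σ i * σ j else 0 := by
  set a : V → ℝ := fun y => ∑ i ∈ s, if c i = y then σ i else 0 with ha
  have hsum : ∑ y, a y = ∑ i ∈ s, σ i := by
    simp only [ha]
    rw [Finset.sum_comm]
    refine Finset.sum_congr rfl fun i _ => ?_
    rw [Finset.sum_ite_eq]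
    simp
  have hsq : ∑ y, a y ^ 2 = ∑ i ∈ s, ∑ j ∈ s, if c i = c j then σ i * σ j else 0 := by
    simp only [ha, sq, Finset.sum_mul_sum]
    rw [Finset.sum_comm]
    refine Finset.sum_congr rfl fun i _ => ?_
    rw [Finset.sum_comm]
    refine Finset.sum_congr rfl fun j _ => ?_
    have h1 : ∀ y, ((if c i = y then σ i else 0) * if c j = y then σ j else 0) =
        if c i = y then (if c j = c i then σ i * σ j else 0) else 0 := by
      intro y
      by_cases hi : c i = y
      · subst hi; simp
      · simp [hi]
    simp_rw [h1]
    rw [Finset.sum_ite_eq]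
    simp [eq_comm]
  have h := sq_sum_le_card_mul_sum_sq (s := (Finset.univ : Finset V)) (f := a)
  rwa [hsum, hsq, Finset.card_univ] at h

/-- **`I(T) ≥ T²/|Λ|`** on the torus `Λ = ℤ^d/nℤ^d` (`n ≥ 1`): "by the Cauchy–Schwarz
inequality, `T = Σ_{x∈Λ} L^x_T ≤ (|Λ| I(T))^{1/2}`". [cite: BauerschmidtBrydgesSlade2015LogCorr, §2 (sentence before the display `χ_N(ν) ≤ ∫₀^∞ e^{-gT²/|Λ_N|}e^{-νT}dT < ∞`)] -/
theorem sq_div_le_torusSelfIntersection (n : ℕ) [NeZero n] (T : ℝ) {x : Site d}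
    (ω : (zdGraph d).Walk 0 x) (s : Fin ω.length → ℝ) :
    T ^ 2 / (n : ℝ) ^ d ≤ torusSelfIntersection n T ω s := by
  classical
  have h := sq_sum_le_card_mul_sum_ite_eq (Finset.univ : Finset (Fin (ω.length + 1)))
    (fun i => Torus.proj n (ω.getVert i)) (sojourns T s)
  rw [sum_sojourns] at h
  have hcard : (Fintype.card (TorusSite d n) : ℝ) = (n : ℝ) ^ d := by simp [ZMod.card]
  rw [hcard] at h
  have hpos : (0 : ℝ) < (n : ℝ) ^ d := pow_pos (Nat.cast_pos.2 (Nat.pos_of_ne_zero (NeZero.ne n))) d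
  rw [div_le_iff₀' hpos]
  exact h

/-- `∫_{Δ_k(T)} e^{-gI_T(X^n)} ds ≤ e^{-gT²/|Λ|} |Δ_k(T)|` (`g ≥ 0`, `n ≥ 1`).
[cite: BauerschmidtBrydgesSlade2015LogCorr, §2 (display `χ_N(ν) ≤ ∫₀^∞ e^{-gT²/|Λ_N|}e^{-νT}dT < ∞`)] -/
theorem torusPathIntegral_le_exp_mul (n : ℕ) [NeZero n] {g : ℝ} (hg : 0 ≤ g) (T : ℝ) {x : Site d}
    (ω : (zdGraph d).Walk 0 x) :
    torusPathIntegral n g T ω ≤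
      ENNReal.ofReal (Real.exp (-(g * T ^ 2 / (n : ℝ) ^ d))) * pathIntegral 0 T ω := by
  rw [pathIntegral_zero_left, ← setLIntegral_const]
  unfold torusPathIntegral
  refine setLIntegral_mono measurable_const fun s' _ => ?_
  refine ENNReal.ofReal_le_ofReal (Real.exp_le_exp.2 ?_)
  have := mul_le_mul_of_nonneg_left (sq_div_le_torusSelfIntersection n T ω s') hg
  rw [neg_mul]
  refine neg_le_neg ?_
  rwa [mul_div_assoc]

/-- **`c_{N,T} ≤ e^{-gT²/|Λ_N|}`** (`g ≥ 0`, `n ≥ 1`, `T > 0`): the bound behind the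
finiteness of `χ_N`. [cite: BauerschmidtBrydgesSlade2015LogCorr, §2 (display `χ_N(ν) ≤ ∫₀^∞ e^{-gT²/|Λ_N|}e^{-νT}dT < ∞`)] -/
theorem torusSurvival_le_exp (n : ℕ) [NeZero n] {g : ℝ} (hg : 0 ≤ g) {T : ℝ} (hT : 0 < T) :
    torusSurvival d n g T ≤ ENNReal.ofReal (Real.exp (-(g * T ^ 2 / (n : ℝ) ^ d))) := by
  set C : ℝ≥0∞ := ENNReal.ofReal (Real.exp (-(g * T ^ 2 / (n : ℝ) ^ d))) with hC
  calc torusSurvival d n g T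
      ≤ ENNReal.ofReal (Real.exp (-(2 * d) * T)) *
          ∑' k : ℕ, ∑ x ∈ box d k, ∑ ω ∈ (zdGraph d).finsetWalkLength k (0 : Site d) x,
            (1 : ℝ≥0∞) * (C * pathIntegral 0 T ω) := by
        unfold torusSurvival torusWeightedExpectation
        refine mul_le_mul' le_rfl (ENNReal.tsum_le_tsum fun k => ?_)
        exact Finset.sum_le_sum fun x _ => Finset.sum_le_sum fun ω _ =>
          mul_le_mul' le_rfl (torusPathIntegral_le_exp_mul n hg T ω)
    _ = C * survival d 0 T := by
        unfold survival weightedExpectation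
        simp only [one_mul]
        simp_rw [← Finset.mul_sum, ENNReal.tsum_mul_left]
        ring
    _ = C := by rw [survival_zero_left d hT, mul_one]

/-- **`χ_N(ν) ≤ ∫₀^∞ e^{-gT²/|Λ_N|} e^{-νT} dT`** for all real `ν` (`g ≥ 0`, `n ≥ 1`).
[cite: BauerschmidtBrydgesSlade2015LogCorr, §2 (display `χ_N(ν) ≤ ∫₀^∞ e^{-gT²/|Λ_N|}e^{-νT}dT < ∞ for all ν ∈ ℝ`)] -/
theorem torusSusceptibility_le_lintegral_exp (n : ℕ) [NeZero n] {g : ℝ} (hg : 0 ≤ g) (ν : ℝ) :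
    torusSusceptibility d n g ν ≤ ∫⁻ T in Ioi (0 : ℝ),
      ENNReal.ofReal (Real.exp (-(g * T ^ 2 / (n : ℝ) ^ d))) *
        ENNReal.ofReal (Real.exp (-ν * T)) := by
  unfold torusSusceptibility
  exact setLIntegral_mono' measurableSet_Ioi fun T hT =>
    mul_le_mul' (torusSurvival_le_exp n hg hT) le_rfl

/-- **`χ_N(ν) < ∞` for every real `ν`** when `g > 0` (`n ≥ 1`): `e^{-gT²/|Λ| - νT} ≤ e^{c - T}`
with `c = (ν-1)²|Λ|/(4g)`. [cite: BauerschmidtBrydgesSlade2015LogCorr, §2 (display `χ_N(ν) ≤ ∫₀^∞ e^{-gT²/|Λ_N|}e^{-νT}dT < ∞ for all ν ∈ ℝ`)] -/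
theorem torusSusceptibility_lt_top (n : ℕ) [NeZero n] {g : ℝ} (hg : 0 < g) (ν : ℝ) :
    torusSusceptibility d n g ν < ∞ := by
  set N : ℝ := (n : ℝ) ^ d with hN
  have hNpos : 0 < N := pow_pos (Nat.cast_pos.2 (Nat.pos_of_ne_zero (NeZero.ne n))) d
  set c : ℝ := (ν - 1) ^ 2 * N / (4 * g) with hc
  refine (torusSusceptibility_le_lintegral_exp n hg.le ν).trans_lt ?_
  calc ∫⁻ T in Ioi (0 : ℝ), ENNReal.ofReal (Real.exp (-(g * T ^ 2 / N))) *
          ENNReal.ofReal (Real.exp (-ν * T))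
      ≤ ∫⁻ T in Ioi (0 : ℝ), ENNReal.ofReal (Real.exp c) * ENNReal.ofReal (Real.exp (-1 * T)) := by
        refine lintegral_mono fun T => ?_
        rw [← ENNReal.ofReal_mul (Real.exp_pos _).le, ← ENNReal.ofReal_mul (Real.exp_pos _).le,
          ← Real.exp_add, ← Real.exp_add]
        refine ENNReal.ofReal_le_ofReal (Real.exp_le_exp.2 ?_)
        have hkey : c + -1 * T - (-(g * T ^ 2 / N) + -ν * T) =
            g / N * (T + (ν - 1) * N / (2 * g)) ^ 2 := by
          rw [hc]; field_simp; ring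
        have h2 : 0 ≤ g / N * (T + (ν - 1) * N / (2 * g)) ^ 2 := by positivity
        linarith
    _ < ∞ := by
        rw [lintegral_const_mul' _ _ ENNReal.ofReal_ne_top]
        exact ENNReal.mul_lt_top ENNReal.ofReal_lt_top
          (exp_neg_integrableOn_Ioi 0 one_pos).lintegral_lt_top

end CTWSAW

end Literature.Barriers.CriticalPhenomena
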